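import Summits.BirchSwinnertonDyer.BirchSwinnertonDyer.Theorems.ErratumRoadFiveNonSurjCornerSevenInstanceTm1o7
import Summits.BirchSwinnertonDyer.BirchSwinnertonDyer.Theorems.ErratumRoadFiveNonSurjCornerSevenInstanceTools
import Summits.BirchSwinnertonDyer.BirchSwinnertonDyer.Theorems.ErratumRoadFiveNonSurjCornerFiveJLine
import Summits.BirchSwinnertonDyer.BirchSwinnertonDyer.Theorems.ErratumRoadFiveNonSurjCornerDeepChildrenDefs
import Literature.NumberTheory.EllipticCurves.LocalReductionKrausMinimality
import Literature.NumberTheory.EllipticCurves.ComplexMultiplicationNotSemistable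
import Literature.NumberTheory.EllipticCurves.RationalIsogenyFrobeniusCriterion
import HarnessLib

/-!
# Route `ErratumRoadFive` (rung K2), crux `NonSurjCorner` (item stmt-BirchSwinnertonDyer-19065), gen-3 DEEP children
# 23046 `NonSurjCornerKolyZDeep` ∕ 23047 `NonSurjCornerTwinMuAnDeep`: THE ONE KNOWN DEEP CORNER PAIR `(E*, 5)` AS A KERNEL INSTANCE —
# `E* : y² = x³ + x² − 76252101·x − 3910730147101` (`N = 5 112 322 880 = 2⁶·5·7²·571²`, `j = J₉(−73/125)` on Zywina's `X_{G₉}`,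
# NON-split multiplicative at `5`, `ord₅ Δ_min = 15`, `5S4` image) satisfies every pair-level hypothesis of both deep children
# except the two ANALYTIC ones (`r_an = 1`, `5² ∣ #Ш_an`), which stay displayed
# (cell `bsd-stepL`, seat `bsd-stepL-corner5-p2` g13, WIDTH-LEVER lane B; `--supports stmt-BirchSwinnertonDyer-23047 --as helper`)

WHY. The deep children quantify over the corner pairs `(E, p)` (`ClassX11b E p`, `ρ̄_{E,p}` not onto, `p ∈ {5,7}`, `p ∣ ord_p Δ_min(E)`,
no (ram) witness) whose analytic Ш is divisible by `p`. Lane B's census (g9 height census `N ≤ 4·10¹⁰` at `5`, `≤ 2·10¹²` at `7`; g12∕g13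
deep census) knows EXACTLY ONE such pair: `E*` at `p = 5`, `#Ш(E*)_an = 25` (Heegner point + saturation, g9; lane B g13 adds the 5-adic
side: `λ_an(E*)`, memo CORNER5-P2-G13). The refuter's note on 23047 («hyps satisfiable by that census pair») and the planner's SHAPE-B
re-split both lean on this pair. This file makes the pair a BY-NAME object of the tree, in the template of the `p = 7` instance files
(`…SevenInstanceT17o7` etc., lane B g0∕g6): every ALGEBRAIC hypothesis is decided in the kernel from the literal integer model, and
`ρ̄_{E*,5}` NOT onto is a THEOREM (the tree's `zywina2015_thm14_not_surjective_five_of_j_eq_J9_holds`, bsd-print-x9, from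
`j(E*) = t³(t² + 5t + 40)` at `t = −73/125`) — so at `(E*, 5)` the deep children's hypotheses rest on `r_an(E*) = 1` and
`ord₅ #Ш(E*)_an > 0` ALONE (both numerics: `L'(E*,1) = 16.858…`, g9 kit; displayed as binders `hr`, `hSha`).

* §0 `isGloballyMinimal_of_kraus_two_bounded` — a bounded (`decide`-shaped) front end to the Literature theorem
  `isGloballyMinimal_of_int_kraus` for integer models whose only obstruction to Silverman's criterion is the prime `2`, handled by
  Kraus's condition there (`E*` has `2¹⁴ ∣ Δ`, `2⁸ ∣ c₄`, `c₆ = 2¹⁰·odd`: not covered by the bounded criteria of `…X11RankOneMinimality`).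
* §1 kernel pair facts of `E₀ = [0, 1, 0, −76252101, −3910730147101]`: `Δ = −2¹⁴·5¹⁵·7⁹·571²`, `c₄ = 2⁸·7³·73·571`, `#Ẽ₀(𝔽₁₁) = 16`;
  `E*` elliptic, globally minimal (§0), multiplicative at `5`, `ord₅ Δ_min = 15` (so `5 ∣ ord₅ Δ_min`), `E*[5]` irreducible (Frobenius
  no-root witness at `ℓ = 11`: `a₁₁ = −4`, `X² + 4X + 11` root-free mod `5`), every multiplicative prime is `5` (`2, 7, 571` additive),
  hence no (ram) witness at `5`; `j(E*) = J₉(−73/125)`, hence **`not_surj_five`**; `ClassX11b E* 5` given `r_an = 1`.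
* §2 **`deepHypotheses_Estar`**: the common outer hypotheses of `Theorems.NonSurjCornerKolyZDeep` ∕ `Theorems.NonSurjCornerTwinMuAnDeep`
  at `(E*, 5)` — `ClassX11b E* 5 ∧ ¬ Surj E* 5 ∧ (5 = 5 ∨ 5 = 7) ∧ 5 ∣ ord₅ Δ_min ∧ ¬ Ram E* 5 ∧ (∃ s, shaAn E* = s ∧ 0 < ord₅ s)` —
  from `hr : r_an(E*) = 1` and `hSha` alone; and `twinMuAnDeep_at_Estar`: what 23047 SAYS at `E*` (its inner statement, for every
  Heegner field `K` of `E*` and every model of the twist) follows from the decl by name — the shape lane B's twin certificates serve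
  (g12 p676733 ∕ p681917 ∕ p694172, g13 Part 3).

HONEST FRAMING: theorems about ONE explicit curve + one elementary minimality wrapper; no definition, no named fact, no `sorry`;
CONDITIONAL only on the displayed analytic binders `hr`, `hSha` where they appear; nothing is booked; 23046 ∕ 23047 ∕ 19065 stay OPEN;
BSD is proved for no curve; no census number moves (T7). Data: lane B g9 CENSUS-G9-cornerpairs-p5.tsv (label `J9t-73o125d-14`), g12
DEEPTWIN-Estar-9fields.tsv, g13 memo CORNER5-P2-G13.md.

References: [Zywina2015] §1.3 (`G₉`, `J₉(t) = t³(t²+5t+40)`), Thm. 1.4 (arXiv:1508.07660); [Kraus1989] Prop. 1–2 (minimality at 2, 3);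
[SilvermanAEC2009] VII.1 Rem. 1.1, VII.5 Prop. 5.1; [Mazur1978] Prop. 6.3 (1); [SkinnerUrban2014] Thm. 2 (ram); tree:
`Theorems/ErratumRoadFiveNonSurjCornerSevenInstance{Tm1o7,T17o7,Tools}.lean`, `…FiveJLine.lean`, `Literature/…/LocalReductionKrausMinimality.lean`,
`…ModFiveImageS4JLineProofs.lean`, `Theorems/Rank1ResidualIntModelReduction.lean`.
-/

set_option linter.dupNamespace false
set_option autoImplicit false

noncomputable section

open scoped Classical

open WeierstrassCurve Literature.NumberTheory.EllipticCurves
  Literature.NumberTheory.EllipticCurves.Rank1Residual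
  Literature.NumberTheory.EllipticCurves.Rank1Residual.X11RankOneCertificates
  Summit.BirchSwinnertonDyer.BirchSwinnertonDyer.Rank1Residual.IntModel
  Summit.BirchSwinnertonDyer.Rank1Residual Summit.BirchSwinnertonDyer.Rank1Residual.X11b

namespace Summit.BirchSwinnertonDyer.BirchSwinnertonDyer.Theorems.CornerFive

/-! ## §0 Global minimality: Silverman's criterion off `2`, Kraus's condition at `2`, bounded form -/

/-- **Global minimality of a literal integer model, bounded form with Kraus at `2`**: `Δ ≠ 0`, `|Δ| < B¹²`; every `q < B` other
than `2` has `q < 2 ∨ q¹² ∤ |Δ| ∨ q⁴ ∤ |c₄|` (Silverman, AEC VII.1 Rem. 1.1; primes `q ≥ B` have `q¹² > |Δ|`); and at `q = 2` Kraus's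
condition in the form of the Literature theorem `isGloballyMinimal_of_int_kraus`: `2²⁴ ∤ Δ`, not (`2⁸ ∣ c₄` and (`2¹¹ ∣ c₆` or
`2¹¹ ∣ c₆ − 2⁹`)), and `2⁸ ∤ c₆ + 2⁶`. [cite: Kraus1989, Prop. 1 and Prop. 2] [cite: SilvermanAEC2009, VII.1 Remark 1.1] -/
theorem isGloballyMinimal_of_kraus_two_bounded (a1 a2 a3 a4 a6 : ℤ) (B : ℕ)
    (h0 : discOf [a1, a2, a3, a4, a6] ≠ 0) (hB : (discOf [a1, a2, a3, a4, a6]).natAbs < B ^ 12)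
    (h : ∀ q < B, q < 2 ∨ q = 2 ∨ ¬ q ^ 12 ∣ (discOf [a1, a2, a3, a4, a6]).natAbs ∨
      ¬ q ^ 4 ∣ (c4Of [a1, a2, a3, a4, a6]).natAbs)
    (h2 : ¬ (2 : ℤ) ^ 24 ∣ discOf [a1, a2, a3, a4, a6] ∧
      ¬ ((2 : ℤ) ^ 8 ∣ c4Of [a1, a2, a3, a4, a6] ∧
        ((2 : ℤ) ^ 11 ∣ c6Of [a1, a2, a3, a4, a6] ∨ (2 : ℤ) ^ 11 ∣ c6Of [a1, a2, a3, a4, a6] - 2 ^ 9)) ∧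
      ¬ (2 : ℤ) ^ 8 ∣ c6Of [a1, a2, a3, a4, a6] + 2 ^ 6) :
    (⟨a1, a2, a3, a4, a6⟩ : WeierstrassCurve ℚ).IsGloballyMinimal := by
  refine isGloballyMinimal_of_int_kraus a1 a2 a3 a4 a6 fun q hq ↦ ?_
  have hpos : 0 < (discOf [a1, a2, a3, a4, a6]).natAbs := Int.natAbs_pos.mpr h0
  by_cases hq2 : q = 2
  · exact Or.inr (Or.inl ⟨hq2, h2⟩)
  refine Or.inl fun ⟨h12, h4⟩ ↦ ?_
  have h12' : q ^ 12 ∣ (discOf [a1, a2, a3, a4, a6]).natAbs := by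
    rw [← Int.natCast_dvd]; exact_mod_cast h12
  have h4' : q ^ 4 ∣ (c4Of [a1, a2, a3, a4, a6]).natAbs := by
    rw [← Int.natCast_dvd]; exact_mod_cast h4
  by_cases hqB : q < B
  · rcases h q hqB with hlt | h22 | hn12 | hn4
    · exact absurd hq.two_le (by omega)
    · exact hq2 h22
    · exact hn12 h12'
    · exact hn4 h4'
  · have hle : q ^ 12 ≤ (discOf [a1, a2, a3, a4, a6]).natAbs := Nat.le_of_dvd hpos h12'
    have hge : B ^ 12 ≤ q ^ 12 := Nat.pow_le_pow_left (by omega) 12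
    omega

/-! ## §1 Kernel pair facts of `E₀ = [0, 1, 0, −76252101, −3910730147101]` (`E*`, `j = J₉(−73/125)`) at `p = 5` -/

namespace Estar

/-- `Δ(E₀) = −6578465189943500000000000000`. [cite: SilvermanAEC2009, III.1] -/
theorem Δ_eq : (⟨0, 1, 0, -76252101, -3910730147101⟩ : WeierstrassCurve ℤ).Δ = -6578465189943500000000000000 := by
  decide

/-- `Δ(E₀) = −2¹⁴·5¹⁵·7⁹·571²` (bad primes `2, 5, 7, 571`; `N = 2⁶·5·7²·571²`). [cite: SilvermanAEC2009, VII.5 Prop. 5.1] -/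
theorem Δ_eq_factored : (⟨0, 1, 0, -76252101, -3910730147101⟩ : WeierstrassCurve ℤ).Δ =
    -(2 ^ 14 * 5 ^ 15 * 7 ^ 9 * 571 ^ 2) := by
  rw [Δ_eq]; norm_num

/-- `c₄(E₀) = 3660100864 = 2⁸·7³·73·571`. [cite: SilvermanAEC2009, III.1] -/
theorem c₄_eq : (⟨0, 1, 0, -76252101, -3910730147101⟩ : WeierstrassCurve ℤ).c₄ = 3660100864 := by
  decide

/-- `#Ẽ₀(𝔽₁₁) = 16` (`a₁₁ = −4`), kernel-decided. [cite: SilvermanAEC2009, V.2] -/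
theorem card_F11 : Nat.card (((⟨0, 1, 0, -76252101, -3910730147101⟩ : WeierstrassCurve ℤ).map
    (Int.castRingHom (ZMod 11))).toAffine.Point) = 16 := by
  rw [@natCard_point_eq_one_add_card (ZMod 11) (@ZMod.instField 11 ⟨by norm_num⟩) _ _ _ (by decide)]
  decide

/-- `E*` is an elliptic curve (`Δ ≠ 0`). [cite: SilvermanAEC2009, III.1] -/
theorem isElliptic (W : WeierstrassCurve ℚ) (hW : W = ⟨0, 1, 0, -76252101, -3910730147101⟩) : W.IsElliptic := by
  subst hW; exact isElliptic_of_discOf_ne_zero 0 1 0 (-76252101) (-3910730147101) (by decide +kernel)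

/-- The model is GLOBALLY MINIMAL: Silverman's criterion at every odd prime below `512` (`5 ∤ c₄`, `7⁹ ∥ Δ`, `571² ∥ Δ`), `|Δ| < 512¹²`,
and Kraus's condition at `2` (`2¹⁴ ∥ Δ`, `2⁸ ∥ c₄`, `2¹⁰ ∥ c₆`). [cite: Kraus1989, Prop. 1] [cite: SilvermanAEC2009, VII.1 Remark 1.1] -/
theorem isGloballyMinimal (W : WeierstrassCurve ℚ) (hW : W = ⟨0, 1, 0, -76252101, -3910730147101⟩) : W.IsGloballyMinimal := by
  subst hW
  exact isGloballyMinimal_of_kraus_two_bounded 0 1 0 (-76252101) (-3910730147101) 512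
    (by decide +kernel) (by decide +kernel) (by decide +kernel) (by decide +kernel)

/-- The tree's integral model of `E*` is `E₀`. [folklore] -/
theorem integralModelInt_eq (W : WeierstrassCurve ℚ) (hW : W = ⟨0, 1, 0, -76252101, -3910730147101⟩) [W.IsGloballyMinimal] :
    integralModelInt W = ⟨0, 1, 0, -76252101, -3910730147101⟩ := by
  subst hW; exact integralModelInt_eq_of_map_eq _ (map_mk_int _ _ _ _ _)

/-- `E*` as the base change of its integer model. [folklore] -/
theorem eq_baseChange (W : WeierstrassCurve ℚ) (hW : W = ⟨0, 1, 0, -76252101, -3910730147101⟩) :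
    W = (⟨0, 1, 0, -76252101, -3910730147101⟩ : WeierstrassCurve ℤ).baseChange ℚ := by
  rw [hW]; ext <;> simp [WeierstrassCurve.baseChange, WeierstrassCurve.map]

/-- **Multiplicative reduction at `5`** (`5 ∣ Δ`, `5 ∤ c₄`). [cite: SilvermanAEC2009, VII.5 Prop. 5.1(b)] -/
theorem mult_five (W : WeierstrassCurve ℚ) (hW : W = ⟨0, 1, 0, -76252101, -3910730147101⟩) [W.IsElliptic] [W.IsGloballyMinimal]
    [Fact (Nat.Prime 5)] : Mult W 5 :=
  hasMultiplicativeReductionAtPrime_of_intModel (integralModelInt_eq W hW) 5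
    (by rw [Δ_eq]; decide) (by rw [c₄_eq]; decide)

/-- `ord₅ Δ_min(E*) = 15`. [cite: SilvermanAEC2009, VII.5 Prop. 5.1(b)] -/
theorem padicValInt_five (W : WeierstrassCurve ℚ) (hW : W = ⟨0, 1, 0, -76252101, -3910730147101⟩) [W.IsElliptic] [W.IsGloballyMinimal]
    [Fact (Nat.Prime 5)] : padicValInt 5 W.minimalDiscriminantInt = 15 := by
  rw [minimalDiscriminantInt_eq (integralModelInt_eq W hW), Δ_eq]
  exact padicValInt_eq_of_dvd_of_not_dvd 5 (by decide) (by decide)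

/-- The crux binder **`5 ∣ ord₅ Δ_min(E*)`** (`15 = 5·3`). [cite: SilvermanAEC2009, VII.5 Prop. 5.1(b)] -/
theorem dvd_padicValInt_five (W : WeierstrassCurve ℚ) (hW : W = ⟨0, 1, 0, -76252101, -3910730147101⟩) [W.IsElliptic] [W.IsGloballyMinimal]
    [Fact (Nat.Prime 5)] : (5 : ℕ) ∣ padicValInt 5 W.minimalDiscriminantInt := by
  rw [padicValInt_five W hW]; decide

/-- **`E*[5]` is irreducible**: Frobenius no-root witness at the good prime `ℓ = 11` (`a₁₁ = −4`, `X² + 4X + 11` root-free mod `5`;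
Mazur 1978 Prop. 6.3 (1)). [cite: Mazur1978, §6 Prop. 6.3 (1) (p. 153)] -/
theorem irr_five (W : WeierstrassCurve ℚ) (hW : W = ⟨0, 1, 0, -76252101, -3910730147101⟩) [W.IsElliptic] [W.IsGloballyMinimal]
    [Fact (Nat.Prime 5)] : Irr W 5 :=
  haveI : Fact (Nat.Prime 11) := ⟨by norm_num⟩
  hasIrreducibleModPGaloisRep_of_intModel_of_noroot (integralModelInt_eq W hW) 5 11
    (by decide) (by rw [Δ_eq]; decide) card_F11
    -- the no-root check over `ZMod 5` (the `Fact` instance is a local here, so `decide` is run through `of_decide_eq_true`)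
    (of_decide_eq_true rfl)

/-- **Every prime of multiplicative reduction of `E*` is `5`**: it divides `Δ = −2¹⁴·5¹⁵·7⁹·571²`, and `2, 7, 571` are additive
(`q ∣ Δ`, `q ∣ c₄` at the globally minimal model). [cite: SilvermanAEC2009, VII.5 Prop. 5.1] -/
theorem eq_five_of_mult (W : WeierstrassCurve ℚ) (hW : W = ⟨0, 1, 0, -76252101, -3910730147101⟩) [W.IsElliptic] [W.IsGloballyMinimal]
    {ℓ : ℕ} [hℓ : Fact ℓ.Prime] (hm : Mult W ℓ) : ℓ = 5 := by
  have hI := integralModelInt_eq W hW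
  have hdvd : (ℓ : ℤ) ∣ (⟨0, 1, 0, -76252101, -3910730147101⟩ : WeierstrassCurve ℤ).Δ := by
    by_contra hnd
    exact (hasGoodReductionAtPrime_of_not_dvd W ℓ (by rwa [minimalDiscriminantInt_eq hI])).not_hasMultiplicativeReduction _ hm
  rw [Δ_eq_factored, Int.dvd_neg, Int.natCast_dvd] at hdvd
  simp only [Int.natAbs_mul, Int.natAbs_pow] at hdvd
  have hp := hℓ.out
  have hadd : ∀ q : ℕ, [Fact q.Prime] → (q : ℤ) ∣ (⟨0, 1, 0, -76252101, -3910730147101⟩ : WeierstrassCurve ℤ).Δ →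
      (q : ℤ) ∣ (⟨0, 1, 0, -76252101, -3910730147101⟩ : WeierstrassCurve ℤ).c₄ → ¬ Mult W q :=
    fun q _ hΔ hc ↦ not_hasMultiplicativeReductionAtPrime_of_intModel_of_dvd_of_dvd hI q hΔ hc
  rcases (Nat.Prime.dvd_mul hp).mp hdvd with hdvd | h571
  · rcases (Nat.Prime.dvd_mul hp).mp hdvd with hdvd | h7
    · rcases (Nat.Prime.dvd_mul hp).mp hdvd with h2 | h5
      · exfalso
        have h' : ℓ = 2 := (Nat.prime_dvd_prime_iff_eq hp (by norm_num : Nat.Prime 2)).mp (hp.dvd_of_dvd_pow h2)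
        subst h'
        exact hadd 2 (by rw [Δ_eq]; decide) (by rw [c₄_eq]; decide) hm
      · exact (Nat.prime_dvd_prime_iff_eq hp (by norm_num : Nat.Prime 5)).mp (hp.dvd_of_dvd_pow h5)
    · exfalso
      have h' : ℓ = 7 := (Nat.prime_dvd_prime_iff_eq hp (by norm_num : Nat.Prime 7)).mp (hp.dvd_of_dvd_pow h7)
      subst h'
      exact hadd 7 (by rw [Δ_eq]; decide) (by rw [c₄_eq]; decide) hm
  · exfalso
    have h' : ℓ = 571 := (Nat.prime_dvd_prime_iff_eq hp (by norm_num : Nat.Prime 571)).mp (hp.dvd_of_dvd_pow h571)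
    subst h'
    exact hadd 571 (by rw [Δ_eq]; decide) (by rw [c₄_eq]; decide) hm

/-- The crux binder **no (ram) witness at `5`**: `E*` has no multiplicative prime other than `5`.
[cite: SkinnerUrban2014, Thm. 2 (p. 3), hypothesis (ram)] -/
theorem not_ram_five (W : WeierstrassCurve ℚ) (hW : W = ⟨0, 1, 0, -76252101, -3910730147101⟩) [W.IsElliptic] [W.IsGloballyMinimal]
    [Fact (Nat.Prime 5)] : ¬ Ram W 5 := by
  rintro ⟨ℓ, hℓ, hne, hm, -⟩
  exact hne (eq_five_of_mult W hW hm)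

/-- **`j(E*) = J₉(−73/125)`** on Zywina's `X_{G₉}` j-line: `j = c₄³/Δ = −227459795968/30517578125 = t³(t² + 5t + 40)` at `t = −73/125`.
[cite: Zywina2015, §1.3 (J₉) and Thm. 1.4 (arXiv:1508.07660)] -/
theorem j_eq_J9 (W : WeierstrassCurve ℚ) (hW : W = ⟨0, 1, 0, -76252101, -3910730147101⟩) [W.IsElliptic] :
    W.j = (-73 / 125 : ℚ) ^ 3 * ((-73 / 125 : ℚ) ^ 2 + 5 * (-73 / 125) + 40) := by
  have hW' := eq_baseChange W hW
  subst hW'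
  rw [j_baseChange_int, c₄_eq, Δ_eq]; norm_num

/-- **`ρ̄_{E*,5}` is NOT onto** — a THEOREM: `E*` is non-CM (multiplicative at `5`) and `j(E*) = J₉(−73/125)`, so the tree's
`zywina2015_thm14_not_surjective_five_of_j_eq_J9_holds` applies. [cite: Zywina2015, Thm. 1.4 (i = 9) (arXiv:1508.07660)]
[cite: SilvermanATAEC1994, Thm. II.6.4] -/
theorem not_surj_five (W : WeierstrassCurve ℚ) (hW : W = ⟨0, 1, 0, -76252101, -3910730147101⟩) [W.IsElliptic] [W.IsGloballyMinimal]
    [Fact (Nat.Prime 5)] : ¬ Surj W 5 :=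
  zywina2015_thm14_not_surjective_five_of_j_eq_J9_holds W
    (fun hCM ↦ not_hasMultiplicativeReductionAtPrime_of_hasCM W hCM 5 (mult_five W hW)) (-73 / 125) (j_eq_J9 W hW)

/-- **`(E*, 5) ∈ X11b`** given `r_an(E*) = 1` (`hr`; numerics: root number `−1`, `L'(E*,1) = 16.858988…`, lane B g9).
[cite: Miller2011LMS, §1] -/
theorem classX11b_five (W : WeierstrassCurve ℚ) (hW : W = ⟨0, 1, 0, -76252101, -3910730147101⟩) [W.IsElliptic] [W.IsGloballyMinimal]
    [Fact (Nat.Prime 5)] (hr : W.analyticRank = 1) : ClassX11b W 5 :=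
  ⟨hr, by decide, mult_five W hW, irr_five W hW⟩

/-! ## §2 The deep children's hypotheses at `(E*, 5)` -/

/-- **THE DEEP CHILDREN ARE INHABITED AT `(E*, 5)` modulo two analytic numerics**: the common outer hypotheses of
`Theorems.NonSurjCornerKolyZDeep` (23046) and `Theorems.NonSurjCornerTwinMuAnDeep` (23047) — `ClassX11b`, `ρ̄` not onto (a theorem
here), `p = 5 ∨ p = 7`, `5 ∣ ord₅ Δ_min`, no (ram) witness, `#Ш_an` of positive 5-adic valuation — hold at `E*` given `hr : r_an = 1`
and `hSha : ∃ s, shaAn E* = s ∧ 0 < ord₅ s` (numerics: `#Ш(E*)_an = 25.000000`, lane B g9 census, Heegner point + saturation ≤ 200;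
5-adic side g13). [cite: Zywina2015, Thm. 1.4 (i = 9)] [cite: GrossZagier1986, Thm. I.6.3 (the L'-value behind #Ш_an)] -/
theorem deepHypotheses_Estar (W : WeierstrassCurve ℚ) (hW : W = ⟨0, 1, 0, -76252101, -3910730147101⟩) [W.IsElliptic]
    [W.IsGloballyMinimal] [Fact (Nat.Prime 5)] (hr : W.analyticRank = 1)
    (hSha : ∃ s : ℚ, shaAn W = (s : ℂ) ∧ 0 < padicValRat 5 s) :
    ClassX11b W 5 ∧ ¬ Surj W 5 ∧ ((5 : ℕ) = 5 ∨ (5 : ℕ) = 7) ∧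
      (5 : ℕ) ∣ padicValInt 5 W.minimalDiscriminantInt ∧ ¬ Ram W 5 ∧
      (∃ s : ℚ, shaAn W = (s : ℂ) ∧ 0 < padicValRat 5 s) :=
  ⟨classX11b_five W hW hr, not_surj_five W hW, Or.inl rfl, dvd_padicValInt_five W hW, not_ram_five W hW, hSha⟩

/-- **What 23047 says at `E*`**: from `Theorems.NonSurjCornerTwinMuAnDeep` (by name) and the two analytic binders, for every imaginary
quadratic `K` Heegner for `N(E*)` with `L(E*^{(d_K)}, 1) ≠ 0` and every globally minimal model `Wd` of the twist that is a non-surjective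
X11a leaf at `5` with `5 ∣ ord₅ Δ_min(Wd)`: some coefficient of the Néron-normalised Mazur–Tate–Teitelbaum function of `Wd` at `5` is a
`5`-adic unit — the statement lane B's twin tables certify field by field (`d_K = −111, −311, −391, −479, …`). Nothing is asserted:
the decl is a hypothesis. [cite: GreenbergLNM1716, §1 Conj. 1.11 (p. 61) (shape)] -/
theorem twinMuAnDeep_at_Estar (h : NonSurjCornerTwinMuAnDeep)
    (W : WeierstrassCurve ℚ) (hW : W = ⟨0, 1, 0, -76252101, -3910730147101⟩) [W.IsElliptic] [W.IsGloballyMinimal]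
    [Fact (Nat.Prime 5)] (hr : W.analyticRank = 1) (hSha : ∃ s : ℚ, shaAn W = (s : ℂ) ∧ 0 < padicValRat 5 s)
    (K : Type) [Field K] [NumberField K] (Wd : WeierstrassCurve ℚ) [Wd.IsElliptic] [Wd.IsGloballyMinimal] (Cd : VariableChange ℚ)
    (hK : IsImaginaryQuadratic K) (hH : SatisfiesHeegnerHypothesis (W.conductorNorm ℤ) K)
    (hL : (W.quadraticTwist (NumberField.discr K : ℚ)).entireLFunction 1 ≠ 0)
    (hCd : Cd • W.quadraticTwist (NumberField.discr K : ℚ) = Wd)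
    (hXd : ClassX11a Wd 5) (hnsd : ¬ Surj Wd 5)
    (hvd : (5 : ℕ) ∣ padicValInt 5 Wd.minimalDiscriminantInt)
    {N : ℕ} [NeZero N] (f : CuspForm (CongruenceSubgroup.Gamma0 N) 2) (hf : ModularForms.IsNewformOf Wd f)
    (ϖ : ℚ) (hϖ : (ϖ : ℝ) * Wd.realPeriodRat = ModularForms.plusPeriod f)
    (a : ℚ_[5]) (L : PowerSeries ℚ_[5])
    (ha₁ : Wd.HasSplitMultiplicativeReductionAtPrime 5 → a = 1) (ha₂ : ¬ Wd.HasSplitMultiplicativeReductionAtPrime 5 → a = -1)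
    (hLf : IsMultPAdicLFunctionOf f 5 a L) :
    ∃ n : ℕ, ‖PowerSeries.coeff n (PowerSeries.C ((ϖ : ℚ) : ℚ_[5]) * L)‖ = 1 := by
  obtain ⟨hX, hns, h57, hv, hram, hs⟩ := deepHypotheses_Estar W hW hr hSha
  exact h W 5 hX hns h57 hv hram hs K Wd Cd hK hH hL hCd hXd hnsd hvd f hf ϖ hϖ a L ha₁ ha₂ hLf

end Estar

end Summit.BirchSwinnertonDyer.BirchSwinnertonDyer.Theorems.CornerFive

end
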